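import Summits.BirchSwinnertonDyer.BirchSwinnertonDyer.Theorems.KolyvaginRankRigidityAtTwoStartFrameNearCore
import Summits.BirchSwinnertonDyer.BirchSwinnertonDyer.Theorems.GenusKolyvaginAtTwoGenusPrimitiveSupplyAtTwoMonskyLemma14b
import HarnessLib

/-!
# Crux U1 `KolyvaginBoundedDefectAtTwo` (stmt-BirchSwinnertonDyer-28083), LINE 17 `regular_core_rigidity`:
# the START FRAME (N3″) and stub S1b `NearCoreExistenceAtTwo` are now UNCONDITIONAL — `h14` is a tree theorem

Width seat `bsd-line-gk2-p5` g19 (cell `bsd-f1-sign2`, SUPPLY lineage of crux 22136 on route `GenusKolyvaginAtTwo`), cross-line delivery to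
the `krr2` lineage of route `KolyvaginRankRigidityAtTwo`; `--supports stmt-BirchSwinnertonDyer-28083` (helper). THEOREMS ONLY (no definition,
no named fact, no `sorry`); nothing here proves U1, a rung or BSD. BSD is NOT proved.

krr2-p2 g16 proved the start frame (`startFrameAtTwo_of_twoSelmerParity`) and S1b VERBATIM (`nearCoreExistenceAtTwo_of_twoSelmerParity`)
CONDITIONAL on the named fact `Monsky1996_lemma14b_twoSelmerRank_parity` (Monsky 1996 Lemma 1.4(b) = Kramer 1981 Thm. 1 parity), which this
seat has now PROVED (`GenusKolyArch.Monsky1996_lemma14b_twoSelmerRank_parity_holds`, file `…GenusPrimitiveSupplyAtTwoMonskyLemma14b`). Feeding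
it in:

* `startFrameAtTwo_holds` — the START FRAME of `Sel_{2^k}(E/K)` on U1's habitat (N3″ of the v5 draft skeleton), unconditionally;
* **`nearCoreExistenceAtTwo_holds`** — the body of the registered stub S1b `NearCoreExistenceAtTwo` of LINE 17 v3 (skeleton sha b4a2711060ce),
  BYTE-FOR-BYTE, unconditionally: inside the skeleton `theorem stub_nearCoreExistenceAtTwo : NearCoreExistenceAtTwo := nearCoreExistenceAtTwo_holds`
  now closes S1b outright (the LEAD of LINE 17 owns that edit).

References: [Monsky1996] Lemma 1.4(b); [Kramer1981] Thm. 1; [MazurRubin2004] Cor. 2.7.3; [Jetchev2008] Prop. 5.3; [GrossLMS1991] §9 Prop. 9.1.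
-/

set_option autoImplicit false
-- the Theorems namespace of this sub repeats the summit name by design (D-0017 nested layout)
set_option linter.dupNamespace false

noncomputable section

open scoped Classical
open Function NumberField IsDedekindDomain WeierstrassCurve Field Finset
open Literature.NumberTheory.EllipticCurves Literature.NumberTheory.EllipticCurves.Jetchev2008
open Literature.NumberTheory.EllipticCurves.KolyvaginPairing
open Literature.NumberTheory.GaloisRepresentations Literature.NumberTheory.GaloisCohomology
open Literature.NumberTheory.GaloisRepresentations.DiscreteGaloisModule (transverseSubgroup SelmerStructure)
open Literature.NumberTheory.Automorphic Literature.NumberTheory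
open Summit.BirchSwinnertonDyer.Rank1Residual
open Summit.BirchSwinnertonDyer.Rank1Residual.JET.SelmerVocabulary

namespace Summit.BirchSwinnertonDyer.BirchSwinnertonDyer.Theorems.KolyvaginAtTwo.RegularWalk

/-- **THE START FRAME of `Sel_{2^k}(E/K)` on U1's habitat, UNCONDITIONALLY** (N3″): krr2-p2 g16's `startFrameAtTwo_of_twoSelmerParity` fed with
the tree theorem `GenusKolyArch.Monsky1996_lemma14b_twoSelmerRank_parity_holds` (2-parity over the Heegner field). [cite: Greenberg1999, §1–2]
[cite: GrossLMS1991, §5 (5.1), §9 Prop. 9.1] [cite: Monsky1996, Lemma 1.4(b)] [cite: Kramer1981, Thm. 1] -/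
theorem startFrameAtTwo_holds :
    ∀ (W : WeierstrassCurve ℚ) [W.IsElliptic] [W.IsGloballyMinimal], ¬ W.HasCM → (Literature.NumberTheory.EllipticCurves.Rank1Residual.GoodOrd W 2 ∨ Literature.NumberTheory.EllipticCurves.Rank1Residual.Mult W 2) → (∀ m : ℕ, W.HasSurjectiveModNGaloisRep (2 ^ m : ℕ)) → ∀ (K : Type) [Field K] [NumberField K], Literature.NumberTheory.EllipticCurves.IsImaginaryQuadratic K → ∀ [NeZero (W.conductorNorm ℤ)], Literature.NumberTheory.EllipticCurves.SatisfiesHeegnerHypothesis (W.conductorNorm ℤ) K → Odd (NumberField.discr K) → NumberField.discr K ≠ -3 → AddSubgroup.torsionBy (W.baseChange K).toAffine.Point (2 : ℤ) = ⊥ → Literature.NumberTheory.EllipticCurves.SatisfiesHeegnerHypothesis 2 K → ∀ (Dt : Literature.NumberTheory.EllipticCurves.ModularForms.ModularParametrizationData W (W.conductorNorm ℤ)) (β : ℤ) (ι : K →+* ℂ) [∀ k : ℕ, NumberField (ringClassField K ι k)], (4 * (W.conductorNorm ℤ : ℤ)) ∣ β ^ 2 - NumberField.discr K → ∀ (τ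 : K ≃ₐ[ℚ] K), τ ≠ 1 →
      ∃ (m : ℕ) (sg : Fin m → ℤ) (i₀ : Fin m) (J d : ℕ), Odd m ∧ (∀ i, sg i = 1 ∨ sg i = -1) ∧
        ∀ k : ℕ, 1 ≤ k → ∃ g : Fin m → galH1Torsion (W.baseChange K) ((2 ^ k : ℕ) : ℤ),
          (∀ i, g i ∈ Jetchev2008.modifiedSelmerGroup W K ι ((2 ^ k : ℕ) : ℤ) 1) ∧
          (∀ i, conjAct W τ ((2 ^ k : ℕ) : ℤ) (g i) = sg i • g i) ∧ addOrderOf (g i₀) = 2 ^ k ∧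
          (∀ u : galH1Torsion (W.baseChange K) ((2 ^ k : ℕ) : ℤ),
            u ∈ Jetchev2008.modifiedSelmerGroup W K ι ((2 ^ k : ℕ) : ℤ) 1 → ∃ b : Fin m → ℤ,
              ∀ ρ ∈ torsionFixing (W.baseChange K) ((2 ^ (k + 1) : ℕ) : ℤ),
                h1Eval (W.baseChange K) ((2 ^ k : ℕ) : ℤ) (((2 : ℤ) ^ J) • u - ∑ i, b i • g i) ρ = 0) ∧
          (∀ b : Fin m → ℤ, (∀ ρ ∈ torsionFixing (W.baseChange K) ((2 ^ (k + 1) : ℕ) : ℤ),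
              h1Eval (W.baseChange K) ((2 ^ k : ℕ) : ℤ) (∑ i, b i • g i) ρ = 0) → ∀ i, (2 : ℤ) ^ (k - d) ∣ b i) :=
  startFrameAtTwo_of_twoSelmerParity GenusKolyArch.Monsky1996_lemma14b_twoSelmerRank_parity_holds

/-- **S1b `NearCoreExistenceAtTwo` (LINE 17 v3, VERBATIM) HOLDS UNCONDITIONALLY**: on U1's habitat there are a depth `r` and an error `κ` such
that at every level `M ≥ 1` and beyond every bound `b` some square-free conductor `n` with exactly `r` prime factors — all Zhang–Kolyvagin primes
at `2`, `> b`, of Kolyvagin index `≥ M` and REGULAR at level `2^M` — carries a near-core vertex `H_{𝓕(n)}` with a class `x` of exact order `2^M`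
and `2^κ · H_{𝓕(n)} ⊆ ℤ x`. krr2-p2 g16's `nearCoreExistenceAtTwo_of_twoSelmerParity` (start frame + regular-prime walk) fed with the tree theorem
`GenusKolyArch.Monsky1996_lemma14b_twoSelmerRank_parity_holds`. [cite: MazurRubin2004, Cor. 2.7.3, §4.1 Prop. 4.1.5] [cite: Jetchev2008, Prop. 5.3]
[cite: GrossLMS1991, §9 Prop. 9.1] [cite: Monsky1996, Lemma 1.4(b)] [cite: Kramer1981, Thm. 1] -/
theorem nearCoreExistenceAtTwo_holds :
    ∀ (W : WeierstrassCurve ℚ) [W.IsElliptic] [W.IsGloballyMinimal], ¬ W.HasCM → (Literature.NumberTheory.EllipticCurves.Rank1Residual.GoodOrd W 2 ∨ Literature.NumberTheory.EllipticCurves.Rank1Residual.Mult W 2) → (∀ m : ℕ, W.HasSurjectiveModNGaloisRep (2 ^ m : ℕ)) → ∀ (K : Type) [Field K] [NumberField K], Literature.NumberTheory.EllipticCurves.IsImaginaryQuadratic K → ∀ [NeZero (W.conductorNorm ℤ)], Literature.NumberTheory.EllipticCurves.SatisfiesHeegnerHypothesis (W.conductorNorm ℤ) K → Odd (NumberField.discr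 K) → NumberField.discr K ≠ -3 → AddSubgroup.torsionBy (W.baseChange K).toAffine.Point (2 : ℤ) = ⊥ → Literature.NumberTheory.EllipticCurves.SatisfiesHeegnerHypothesis 2 K → ∀ (Dt : Literature.NumberTheory.EllipticCurves.ModularForms.ModularParametrizationData W (W.conductorNorm ℤ)) (β : ℤ) (ι : K →+* ℂ) [∀ k : ℕ, NumberField (ringClassField K ι k)], (4 * (W.conductorNorm ℤ : ℤ)) ∣ β ^ 2 - NumberField.discr K →
    ∃ r κ : ℕ, ∀ (M b : ℕ), 1 ≤ M →
      ∃ n : ℕ, Squarefree n ∧ n.primeFactors.card = r ∧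
        (∀ ℓ ∈ n.primeFactors, Literature.NumberTheory.EllipticCurves.Zhang2014.IsKolyvaginPrime (W.conductorNorm ℤ) W K 2 ℓ ∧ b < ℓ ∧
          M ≤ Literature.NumberTheory.EllipticCurves.Zhang2014.kolyvaginIndex W 2 ℓ ∧ (∃ (v : HeightOneSpectrum (𝓞 ℚ)) (𝔓 : Ideal (absIntegers (𝓞 ℚ) ℚ)) (h : absoluteGaloisGroup ℚ), (ℓ : 𝓞 ℚ) ∈ v.asIdeal ∧ 𝔓 ∈ v.primesAbove ∧ IsArithFrobAt (𝓞 ℚ) h 𝔓 ∧ (∀ X : geomTorsion W ((2 ^ M : ℕ) : ℤ), h • h • X = X) ∧ ∃ P : geomTorsion W ((2 ^ M : ℕ) : ℤ), (2 : ℤ) ^ (M - 1) • (P + h • P) ≠ 0)) ∧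
        (∃ x ∈ Jetchev2008.modifiedSelmerGroup W K ι ((2 ^ M : ℕ) : ℤ) n, addOrderOf x = 2 ^ M ∧ ∀ y ∈ Jetchev2008.modifiedSelmerGroup W K ι ((2 ^ M : ℕ) : ℤ) n, ∃ t : ℤ, (2 ^ κ : ℤ) • y = t • x) :=
  nearCoreExistenceAtTwo_of_twoSelmerParity GenusKolyArch.Monsky1996_lemma14b_twoSelmerRank_parity_holds

end Summit.BirchSwinnertonDyer.BirchSwinnertonDyer.Theorems.KolyvaginAtTwo.RegularWalk

end
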